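import Mathlib.Analysis.SpecialFunctions.Complex.Arg
import Mathlib.Analysis.SpecialFunctions.Complex.Circle
import Mathlib.MeasureTheory.Integral.IntervalIntegral.Periodic
import Mathlib.MeasureTheory.Measure.Lebesgue.EqHaar
import Mathlib.Analysis.SpecialFunctions.Log.Basic
import HarnessLib

/-!
# [AbsTopIII] Proposition 5.7 (ii): radial and angular (log-)volumes on a complex archimedean field

Mochizuki, *Topics in Absolute Anabelian Geometry III*, Prop. 5.7 (ii), kurims manuscript p. 138, read on
the page: "Suppose that `k` is archimedean; thus, we have a natural decomposition `k^× ≅ O_k^× × ℝ_{>0}`,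
where `O_k^× ≅ S¹`, and we note that the projection `k^× → ℝ_{>0}` extends to a continuous map
`pr_ℝ : k → ℝ`. Write `M(k)` (respectively, `M̆(k)`) for the set of nonempty compact subsets `A ⊆ k`
(respectively, `A ⊆ k^×`) such that `A` projects to a [compact] subset of `ℝ` (respectively, `O_k^×`)
which is the closure of its interior … (a) The standard `ℝ`-valued absolute value on `k` determines a
Riemannian metric … on `k` that restricts to Riemannian metrics on `O_k^× ≅ O_k^× × {1} ↪ k^×` and
`ℝ_{>0} ≅ {1} × ℝ_{>0} ↪ k^×`. Integrating these metrics over the projection of `A ∈ M(k)` (respectively,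
`A ∈ M̆(k)`) to `ℝ` (respectively, `O_k^×`) [i.e., "computing the length of `A` relative to these
metrics"] yields a map `μ_k : M(k) → ℝ_{>0}` (respectively, `μ̆_k : M̆(k) → ℝ_{>0}`) that satisfies …
(1) additivity … [for] `A, B` whose projections … are disjoint; (2) normalization, i.e., `μ_k(O_k) = 1`
(respectively, `μ̆_k(O_k^×) = 2π`). We shall refer to `μ_k(−)` (respectively, `μ̆_k(−)`) as the radial
volume (respectively, angular volume) on `k` … `μ^log_k(−) := log(μ_k(−))` … the radial log-volume
(respectively, angular log-volume). (b) Let `x ∈ k^×`; set `μ̇_k(x) := μ_k(x·O_k)` … Then …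
`μ^log_k(x·A) = μ^log_k(A) + μ̇^log_k(x)` (respectively, `μ̆^log_k(x·A) = μ̆^log_k(A)`); in particular,
if `x ∈ O_k^×`, then `μ^log_k(x·A) = μ^log_k(A)`."
[IUTchIII] Prop. 3.9 (i) (kurims p. 116) uses the radial log-volume, "normalized so that multiplication
… by `e = 2.71828...` corresponds to adding the quantity `1 = log(e) ∈ ℝ`".

This file constructs these objects for `k = ℂ` (every complex archimedean field is isomorphic to `ℂ` as
a topological field): `radialProj = pr_ℝ = ‖·‖`, `radialVolume A` = Lebesgue length of `pr_ℝ(A)`,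
`radialLogVolume`, `angleProj : ℂ → ℝ/2πℤ` (`z ↦ arg z`), `angularVolume A` = Haar length of the
angular projection (total mass `2π`); and PROVES (a)(2) (`radialVolume_closedBall_one`,
`angularVolume_sphere`), (a)(1) in the form "volume of a union with disjoint projections", (b)
(`radialVolume_smul`, `radialLogVolume_smul`, `angularVolume_smul`), and the `e`-normalisation
(`radialLogVolume_exp_smul`). The regularity condition defining `M(k)` ("closure of its interior") plays
no role in these identities and is recorded only as the predicate `IsRadiallyRegular`.
[cite: MochizukiAbsTopIII2015, Prop. 5.7 (ii) p. 138] [cite: Mochizuki2012, IUTchIII Prop. 3.9 (i) p. 116]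
Deliberately NOT here: the exponential compatibility (c), tensor products / direct sums of copies of `ℂ`
([IUTchIV] Prop. 1.5), any judgement on [IUTchIII] Cor. 3.12.
-/

noncomputable section

open MeasureTheory MeasureTheory.Measure Set Metric
open scoped ENNReal NNReal Pointwise Real

namespace Literature.IUT.LogVolume

/-- `0 < 2π`, as a `Fact` (needed for Mathlib's Haar measure `volume` on `ℝ/2πℤ = AddCircle (2π)`).
[folklore] -/
instance fact_zero_lt_two_pi : Fact (0 < 2 * Real.pi) := ⟨Real.two_pi_pos⟩

/-! ### The radial projection and the radial volume -/

/-- `pr_ℝ : k → ℝ`, `z ↦ |z|` ("the projection `k^× → ℝ_{>0}` extends to a continuous map `pr_ℝ : k → ℝ`").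
[cite: MochizukiAbsTopIII2015, Prop. 5.7 (ii) p. 138] -/
def radialProj (z : ℂ) : ℝ := ‖z‖

/-- `pr_ℝ` is continuous. [cite: MochizukiAbsTopIII2015, Prop. 5.7 (ii) p. 138] -/
theorem continuous_radialProj : Continuous radialProj := continuous_norm

/-- `M(k)`-regularity as printed: "`A` projects to a [compact] subset of `ℝ` which is the closure of its
interior in `ℝ`" (recorded; not needed for the identities below).
[cite: MochizukiAbsTopIII2015, Prop. 5.7 (ii) p. 138] -/
def IsRadiallyRegular (A : Set ℂ) : Prop :=
  A.Nonempty ∧ IsCompact A ∧ closure (interior (radialProj '' A)) = radialProj '' A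

/-- **The radial volume** `μ_k(A)`: the length (Lebesgue measure) of the radial projection `pr_ℝ(A) ⊆ ℝ`
("Integrating these metrics over the projection of `A` … to `ℝ` … [i.e., computing the length of `A`
…]"). [cite: MochizukiAbsTopIII2015, Prop. 5.7 (ii)(a) p. 138] -/
def radialVolume (A : Set ℂ) : ℝ≥0∞ := volume (radialProj '' A)

/-- **The radial log-volume** `μ^log_k(A) := log μ_k(A)`. [cite: MochizukiAbsTopIII2015, Prop. 5.7 (ii)(a) p. 138] -/
def radialLogVolume (A : Set ℂ) : ℝ := Real.log (radialVolume A).toReal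

/-- The radial projection of the closed unit disc `O_k` is `[0, 1]`.
[cite: MochizukiAbsTopIII2015, Prop. 5.7 (ii)(a)(2) p. 138] -/
theorem radialProj_image_closedBall_one : radialProj '' closedBall (0 : ℂ) 1 = Icc 0 1 := by
  ext r
  simp only [radialProj, mem_image, mem_closedBall, dist_zero_right, mem_Icc]
  constructor
  · rintro ⟨z, hz, rfl⟩
    exact ⟨norm_nonneg z, hz⟩
  · rintro ⟨h0, h1⟩
    exact ⟨(r : ℂ), by simpa [abs_of_nonneg h0] using h1, by simp [abs_of_nonneg h0]⟩

/-- **Normalisation (2)**: `μ_k(O_k) = 1`. [cite: MochizukiAbsTopIII2015, Prop. 5.7 (ii)(a)(2) p. 138] -/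
@[simp] theorem radialVolume_closedBall_one : radialVolume (closedBall (0 : ℂ) 1) = 1 := by
  rw [radialVolume, radialProj_image_closedBall_one, Real.volume_Icc]
  simp

/-- `μ^log_k(O_k) = 0`. [cite: MochizukiAbsTopIII2015, Prop. 5.7 (ii)(a)(2) p. 138] -/
@[simp] theorem radialLogVolume_closedBall_one : radialLogVolume (closedBall (0 : ℂ) 1) = 0 := by
  simp [radialLogVolume]

/-- **Additivity (1)**: `μ_k(A ∪ B) = μ_k(A) + μ_k(B)` for `A`, `B` "whose projections to `ℝ` are
disjoint" (with `pr_ℝ(B)` measurable, e.g. `B` compact).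
[cite: MochizukiAbsTopIII2015, Prop. 5.7 (ii)(a)(1) p. 138] -/
theorem radialVolume_union {A B : Set ℂ} (hB : MeasurableSet (radialProj '' B))
    (h : Disjoint (radialProj '' A) (radialProj '' B)) :
    radialVolume (A ∪ B) = radialVolume A + radialVolume B := by
  rw [radialVolume, image_union, measure_union h hB, radialVolume, radialVolume]

/-- The radial projection of a compact set is compact (hence measurable, of finite length).
[cite: MochizukiAbsTopIII2015, Prop. 5.7 (ii)(a) p. 138] -/
theorem isCompact_radialProj_image {A : Set ℂ} (hA : IsCompact A) : IsCompact (radialProj '' A) :=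
  hA.image continuous_radialProj

/-- Compact sets have finite radial volume. [cite: MochizukiAbsTopIII2015, Prop. 5.7 (ii)(a) p. 138] -/
theorem radialVolume_lt_top {A : Set ℂ} (hA : IsCompact A) : radialVolume A < ∞ :=
  (isCompact_radialProj_image hA).measure_lt_top

/-! ### (b) Scaling: `μ̇_k(x) = |x|` -/

/-- `pr_ℝ(x·A) = |x|·pr_ℝ(A)`. [cite: MochizukiAbsTopIII2015, Prop. 5.7 (ii)(b) p. 138] -/
theorem radialProj_image_smul (x : ℂ) (A : Set ℂ) :
    radialProj '' (x • A) = ‖x‖ • (radialProj '' A) := by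
  ext r
  simp only [radialProj, mem_image, Set.mem_smul_set, smul_eq_mul]
  constructor
  · rintro ⟨_, ⟨a, ha, rfl⟩, rfl⟩
    exact ⟨‖a‖, ⟨a, ha, rfl⟩, by rw [norm_mul]⟩
  · rintro ⟨_, ⟨a, ha, rfl⟩, rfl⟩
    exact ⟨x * a, ⟨a, ha, rfl⟩, norm_mul x a⟩

/-- **`μ_k(x·A) = |x|·μ_k(A)`**. [cite: MochizukiAbsTopIII2015, Prop. 5.7 (ii)(b) p. 138] -/
theorem radialVolume_smul (x : ℂ) (A : Set ℂ) :
    radialVolume (x • A) = ENNReal.ofReal ‖x‖ * radialVolume A := by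
  rw [radialVolume, radialProj_image_smul, Measure.addHaar_smul, radialVolume]
  simp [abs_of_nonneg (norm_nonneg x)]

/-- `μ̇_k(x) := μ_k(x·O_k)`. [cite: MochizukiAbsTopIII2015, Prop. 5.7 (ii)(b) p. 138] -/
def radialMulVolume (x : ℂ) : ℝ≥0∞ := radialVolume (x • closedBall (0 : ℂ) 1)

/-- `μ̇_k(x) = |x|`. [cite: MochizukiAbsTopIII2015, Prop. 5.7 (ii)(b) p. 138] -/
theorem radialMulVolume_eq (x : ℂ) : radialMulVolume x = ENNReal.ofReal ‖x‖ := by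
  rw [radialMulVolume, radialVolume_smul, radialVolume_closedBall_one, mul_one]

/-- `μ̇^log_k(x) := log μ̇_k(x) = log |x|`. [cite: MochizukiAbsTopIII2015, Prop. 5.7 (ii)(b) p. 138] -/
def radialMulLogVolume (x : ℂ) : ℝ := Real.log (radialMulVolume x).toReal

/-- `μ̇^log_k(x) = log |x|`. [cite: MochizukiAbsTopIII2015, Prop. 5.7 (ii)(b) p. 138] -/
theorem radialMulLogVolume_eq (x : ℂ) : radialMulLogVolume x = Real.log ‖x‖ := by
  rw [radialMulLogVolume, radialMulVolume_eq, ENNReal.toReal_ofReal (norm_nonneg x)]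

/-- **(b)**: `μ^log_k(x·A) = μ^log_k(A) + μ̇^log_k(x)` for `x ∈ k^×` and `A` of positive finite radial
volume. [cite: MochizukiAbsTopIII2015, Prop. 5.7 (ii)(b) p. 138] -/
theorem radialLogVolume_smul {x : ℂ} (hx : x ≠ 0) {A : Set ℂ} (hA : 0 < radialVolume A)
    (hA' : radialVolume A < ∞) :
    radialLogVolume (x • A) = radialLogVolume A + radialMulLogVolume x := by
  rw [radialLogVolume, radialVolume_smul, ENNReal.toReal_mul, ENNReal.toReal_ofReal (norm_nonneg x),
    Real.log_mul (norm_ne_zero_iff.mpr hx) (ENNReal.toReal_pos hA.ne' hA'.ne).ne', radialMulLogVolume_eq,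
    radialLogVolume, add_comm]

/-- "in particular, if `x ∈ O_k^×`, then `μ^log_k(x·A) = μ^log_k(A)`" — indeed `μ_k(x·A) = μ_k(A)` for
`|x| = 1`. [cite: MochizukiAbsTopIII2015, Prop. 5.7 (ii)(b) p. 138] -/
theorem radialVolume_smul_of_norm_eq_one {x : ℂ} (hx : ‖x‖ = 1) (A : Set ℂ) :
    radialVolume (x • A) = radialVolume A := by
  rw [radialVolume_smul, hx]
  simp

/-- **The `e`-normalisation of [IUTchIII] Prop. 3.9 (i)**: multiplication by `e = 2.71828…` adds
`1 = log(e)` to the radial log-volume. [cite: Mochizuki2012, IUTchIII Prop. 3.9 (i) p. 116] -/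
theorem radialLogVolume_exp_smul {A : Set ℂ} (hA : 0 < radialVolume A) (hA' : radialVolume A < ∞) :
    radialLogVolume (((Real.exp 1 : ℝ) : ℂ) • A) = radialLogVolume A + 1 := by
  rw [radialLogVolume_smul (by exact_mod_cast (Real.exp_pos 1).ne') hA hA', radialMulLogVolume_eq,
    Complex.norm_real, Real.norm_eq_abs, abs_of_pos (Real.exp_pos 1), Real.log_exp]

/-! ### The angular projection and the angular volume -/

/-- The angular projection `k^× → O_k^× ≅ S¹ ≅ ℝ/2πℤ`, `z ↦ arg z (mod 2π)` (junk value `0` at `z = 0`).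
[cite: MochizukiAbsTopIII2015, Prop. 5.7 (ii) p. 138] -/
def angleProj (z : ℂ) : AddCircle (2 * Real.pi) := ((Complex.arg z : ℝ) : AddCircle (2 * Real.pi))

/-- `arg` is multiplicative modulo `2π`: `angleProj (x·z) = angleProj x + angleProj z` on `k^×`.
[cite: MochizukiAbsTopIII2015, Prop. 5.7 (ii) p. 138] -/
theorem angleProj_mul {x z : ℂ} (hx : x ≠ 0) (hz : z ≠ 0) :
    angleProj (x * z) = angleProj x + angleProj z :=
  Complex.arg_mul_coe_angle hx hz

/-- **The angular volume** `μ̆_k(A)`: the length (Haar measure of total mass `2π` on `ℝ/2πℤ`) of the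
angular projection of `A ⊆ k^×`. [cite: MochizukiAbsTopIII2015, Prop. 5.7 (ii)(a) p. 138] -/
def angularVolume (A : Set ℂ) : ℝ≥0∞ := volume (angleProj '' A)

/-- **The angular log-volume** `μ̆^log_k(A) := log μ̆_k(A)`. [cite: MochizukiAbsTopIII2015, Prop. 5.7 (ii)(a) p. 138] -/
def angularLogVolume (A : Set ℂ) : ℝ := Real.log (angularVolume A).toReal

/-- The unit circle `O_k^×` projects ONTO `ℝ/2πℤ`. [cite: MochizukiAbsTopIII2015, Prop. 5.7 (ii)(a)(2) p. 138] -/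
theorem angleProj_image_sphere : angleProj '' sphere (0 : ℂ) 1 = univ := by
  refine eq_univ_of_forall fun θ => ?_
  induction θ using QuotientAddGroup.induction_on with
  | H t =>
    refine ⟨Circle.exp t, by simp, ?_⟩
    change ((Complex.arg (Circle.exp t) : ℝ) : AddCircle (2 * Real.pi)) = ((t : ℝ) : AddCircle _)
    rw [Circle.coe_exp, Complex.arg_exp_mul_I, ← self_sub_toIocDiv_zsmul, AddCircle.coe_sub,
      AddCircle.coe_zsmul, AddCircle.coe_period, smul_zero, sub_zero]

/-- **Normalisation (2)**: `μ̆_k(O_k^×) = 2π`. [cite: MochizukiAbsTopIII2015, Prop. 5.7 (ii)(a)(2) p. 138] -/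
theorem angularVolume_sphere : angularVolume (sphere (0 : ℂ) 1) = ENNReal.ofReal (2 * Real.pi) := by
  rw [angularVolume, angleProj_image_sphere]
  exact AddCircle.measure_univ (2 * Real.pi)

/-- **Additivity (1)** for the angular volume: disjoint angular projections add (with measurability).
[cite: MochizukiAbsTopIII2015, Prop. 5.7 (ii)(a)(1) p. 138] -/
theorem angularVolume_union {A B : Set ℂ} (hB : MeasurableSet (angleProj '' B))
    (h : Disjoint (angleProj '' A) (angleProj '' B)) :
    angularVolume (A ∪ B) = angularVolume A + angularVolume B := by
  rw [angularVolume, image_union, measure_union h hB, angularVolume, angularVolume]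

/-- Rotations act on angular projections by translation: `angleProj(x·A) = arg x + angleProj(A)` for
`A ⊆ k^×`. [cite: MochizukiAbsTopIII2015, Prop. 5.7 (ii)(b) p. 138] -/
theorem angleProj_image_smul {x : ℂ} (hx : x ≠ 0) {A : Set ℂ} (hA : A ⊆ {0}ᶜ) :
    angleProj '' (x • A) = angleProj x +ᵥ (angleProj '' A) := by
  ext θ
  simp only [mem_image, Set.mem_smul_set, smul_eq_mul, Set.mem_vadd_set, vadd_eq_add]
  constructor
  · rintro ⟨_, ⟨a, ha, rfl⟩, rfl⟩
    exact ⟨angleProj a, ⟨a, ha, rfl⟩, (angleProj_mul hx (hA ha)).symm⟩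
  · rintro ⟨_, ⟨a, ha, rfl⟩, rfl⟩
    exact ⟨x * a, ⟨a, ha, rfl⟩, angleProj_mul hx (hA ha)⟩

/-- **(b), angular**: `μ̆_k(x·A) = μ̆_k(A)` for `x ∈ k^×`, `A ⊆ k^×` (translation invariance on `ℝ/2πℤ`),
hence `μ̆^log_k(x·A) = μ̆^log_k(A)`. [cite: MochizukiAbsTopIII2015, Prop. 5.7 (ii)(b) p. 138] -/
theorem angularVolume_smul {x : ℂ} (hx : x ≠ 0) {A : Set ℂ} (hA : A ⊆ {0}ᶜ) :
    angularVolume (x • A) = angularVolume A := by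
  rw [angularVolume, angleProj_image_smul hx hA, measure_vadd, angularVolume]

/-- Log form of (b), angular: `μ̆^log_k(x·A) = μ̆^log_k(A)`.
[cite: MochizukiAbsTopIII2015, Prop. 5.7 (ii)(b) p. 138] -/
theorem angularLogVolume_smul {x : ℂ} (hx : x ≠ 0) {A : Set ℂ} (hA : A ⊆ {0}ᶜ) :
    angularLogVolume (x • A) = angularLogVolume A := by
  rw [angularLogVolume, angularVolume_smul hx hA, angularLogVolume]

end Literature.IUT.LogVolume
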